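import Summits.BirchSwinnertonDyer.BirchSwinnertonDyer.Theorems.ByReductionTypeAtTwoSemistableKatoHalfSharp
import HarnessLib

/-!
# Crux `MultUpperHalfAtTwo` (K4 item 19922): the BY-NAME DOOR on the irreducible-`E[2]` locus — the crux from Kato's
# SHARP rank-`0` reading at a multiplicative `2` + Coates–Sujatha's (A) on the irreducible classes + the upper half on the
# REDUCIBLE classes (seat `bsd-2adic-addL2x` GEN 14, on the pen's word RC-305 (1)(i); `--supports 19922 --as helper`)

HONEST FRAMING (cell `bsd-2adic`, HUMAN RULING D-0036/D-0054): types-the-object-of; the ∀-item 19922 stays OPEN (its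
residual = the 296 `E[2]`-REDUCIBLE rank-`0` classes + statement (A) on the `S₃`-image classes); nothing booked; BSD is
not proved by any of this. PARTITION: lane mult-2's registered line `four_roads` and its `MultUpperHalvesAtTwo.*` leaves
are NOT touched or restated; this is a door BESIDE them (inputs, not facts, until audit-2's D-audit of p658927 PASSES —
RC-305/RC-307).

The two theorems are the simple-binder forms of `SemistableKatoTwo.multUpperHalfAtTwo_of_katoAtTwoMult_of_conjA_of_reducible`
(file `…SemistableKatoHalfSharp.lean`, p659305, which splits the (A)-binder by abelian / non-abelian `ℚ(E[2])` and
discharges the abelian part from Lim@2 + FW): here (A) is ONE binder over the whole irreducible multiplicative rank-`0`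
locus (1 673/1 969 census classes: 590 split + 1 083 non-split; no `2`-adic surjectivity, no sign of `Δ`, no
`μ(X)`-certificate, no `2`-adic `L`-function), and the reducible residual is the other.

References: [Kato2004Asterisque] Thm. 12.5 (1)(3), (12.5.1) (pp. 221–222), 13.13 (pp. 233–234), 14.14–14.16
(pp. 243–245); [Tate1975] §1; [CoatesSujatha2005] statement (A); [Miller2011LMS] Def. 1.1;
memo `run/shared/lean/pub/bsd-2adic/addL2x/VERDICT-19098-addL2x-GEN14.md`.
-/

set_option autoImplicit false
-- sibling precedent (`ByReductionTypeAtTwoSemistableKatoHalfSharp.lean`): the directory name repeats the summit name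
set_option linter.dupNamespace false

noncomputable section

open scoped Classical

namespace Summit.BirchSwinnertonDyer.BirchSwinnertonDyer.Theorems.SemistableKatoTwo

open WeierstrassCurve Literature.NumberTheory.EllipticCurves
  Literature.NumberTheory.EllipticCurves.Rank1Residual
  Literature.NumberTheory.EllipticCurves.Rank1Residual.Typed
  Summit.BirchSwinnertonDyer.BirchSwinnertonDyer.Theses.ByReductionTypeAtTwo

/-- **The Kato half on the whole irreducible multiplicative rank-`0` locus from ONE (A)-binder**: granted the reading
`hKM`, GZK, modularity and statement (A) at `(W,2)` for every non-CM rank-`0` `W` multiplicative at `2` with irreducible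
`E[2]` (`hAIrr`), every such `W` has `MissingUpperBoundAt W 2`. Conditional; closes nothing.
[cite: Kato2004Asterisque, Thm. 12.5 (3) and (12.5.1) (p. 222), 13.13 (pp. 233–234), 14.14 (p. 243)]
[cite: CoatesSujatha2005, statement (A)] [cite: Miller2011LMS, Def. 1.1] -/
theorem multUpperHalfAtTwo_onIrr_of_katoAtTwoMult_of_conjA
    (hKM : Kato2004.rankZero_padicValNat_sha_add_padicValNat_tamagawa_le_at_two_of_multiplicative_of_irreducible_of_fineSelmerDual_fg)
    (hGZK : rank_eq_analyticRank_of_analyticRank_le_one) (hmod : hasEntireLFunction_rat)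
    (hAIrr : ∀ (W : WeierstrassCurve ℚ) [W.IsElliptic] [W.IsGloballyMinimal], ¬ W.HasCM → W.analyticRank = 0 →
      Mult W 2 → W.HasIrreducibleModPGaloisRep 2 →
      ∀ (κ : ZpExtension ℚ 2), κ.IsCyclotomic →
        ∃ (γ : Field.absoluteGaloisGroup ℚ) (D : W.FineSelmerDualData κ γ),
          Module.Finite ℤ_[2] (RestrictScalars ℤ_[2] (IwasawaAlgebra 2) D.X)) :
    ∀ (W : WeierstrassCurve ℚ) [W.IsElliptic] [W.IsGloballyMinimal], ¬ W.HasCM → W.analyticRank = 0 →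
      Mult W 2 → W.HasIrreducibleModPGaloisRep 2 → MissingUpperBoundAt W 2 := by
  intro W _ _ hcm hr hmult hirr
  exact missingUpperBoundAt_two_of_katoAtTwoMult hKM hGZK hmod W hcm hr hmult hirr (hAIrr W hcm hr hmult hirr)

/-- **The crux `MultUpperHalfAtTwo` (item 19922) BY NAME from the reading, ONE (A)-binder on the irreducible locus,
and the REDUCIBLE residual** (`hRed`: the upper half on the rank-`0` multiplicative curves with a rational point of
order `2` — census 296/1 969 classes, the habitat of Greenberg's Props. 5.13/5.14 and of the registered line's
μ-roads). Inputs not facts (RC-305); the item stays open. [cite: Kato2004Asterisque, Thm. 12.5 (3) and (12.5.1) (p. 222), 13.13 (pp. 233–234), 14.14 (p. 243)]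
[cite: CoatesSujatha2005, statement (A)] [cite: GreenbergLNM1716, Prop. 5.13 and Prop. 5.14 (shape of the reducible residual)] -/
theorem multUpperHalfAtTwo_of_katoAtTwoMult_of_conjAOnIrr_of_reducibleUpper
    (hKM : Kato2004.rankZero_padicValNat_sha_add_padicValNat_tamagawa_le_at_two_of_multiplicative_of_irreducible_of_fineSelmerDual_fg)
    (hGZK : rank_eq_analyticRank_of_analyticRank_le_one) (hmod : hasEntireLFunction_rat)
    (hAIrr : ∀ (W : WeierstrassCurve ℚ) [W.IsElliptic] [W.IsGloballyMinimal], ¬ W.HasCM → W.analyticRank = 0 →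
      Mult W 2 → W.HasIrreducibleModPGaloisRep 2 →
      ∀ (κ : ZpExtension ℚ 2), κ.IsCyclotomic →
        ∃ (γ : Field.absoluteGaloisGroup ℚ) (D : W.FineSelmerDualData κ γ),
          Module.Finite ℤ_[2] (RestrictScalars ℤ_[2] (IwasawaAlgebra 2) D.X))
    (hRed : ∀ (W : WeierstrassCurve ℚ) [W.IsElliptic] [W.IsGloballyMinimal], ¬ W.HasCM → W.analyticRank = 0 →
      Mult W 2 → ¬ W.HasIrreducibleModPGaloisRep 2 → MissingUpperBoundAt W 2) :
    MultUpperHalfAtTwo := by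
  intro W _ _ hcm hr hmult
  by_cases hirr : W.HasIrreducibleModPGaloisRep 2
  · exact multUpperHalfAtTwo_onIrr_of_katoAtTwoMult_of_conjA hKM hGZK hmod hAIrr W hcm hr hmult hirr
  · exact hRed W hcm hr hmult hirr

end Summit.BirchSwinnertonDyer.BirchSwinnertonDyer.Theorems.SemistableKatoTwo

end
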